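import Literature.MathematicalPhysics.QuantumFieldTheory.Balaban1983to89.T3DescentSection
import Literature.MathematicalPhysics.QuantumFieldTheory.Balaban1983to89.BlockAveragingSectionPlaq
import HarnessLib

/-!
# `Balaban1983to89.T3SmallFibre` — rung R3, crux K1: the SMALL-FIELD part of every descent fibre of a small datum is nonempty

Cell `ym3-torus` (HUMAN RULING D-0037, YM ladder rung R3), seat `ym3-torus-p1` gen 4 (cell record HOME/UV3-NODE.md §11.3 G-K1a-5).  The
iterated face section of `BlockAveragingSection`/`BlockAveragingSectionPlaq` inverts the descent `D_{n,K}` AND preserves `PlaqSmall δ`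
(`δ > 0`): for every `δ`-small datum `V` on the comparison lattice there is a `δ`-small fine configuration `U` of run `K` with
`D_{n,K}U = V`.  Consequence for `T3ConstrainedMinimiser.minAction`: the infimum over the ABSOLUTELY small part `fibre(V) ∩ {PlaqSmall δ}`
of the fibre is over a nonempty set, and `minAction V ≤ A(U)` is witnessed by a small `U`.  (This is smallness at the datum's own
threshold — NOT Bałaban's scaled regularity `ε₀L^{−2(K−n)}` of `T3RegularMinimiser.regFibre`, whose nonemptiness for small data is
[Balaban1985Variational] Thm 1 and is not claimed here.)  Elementary; no estimate.
-/

noncomputable section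

open Literature.MathematicalPhysics.QuantumFieldTheory.Balaban1983to89.T3ContinuumYM3Torus
open Literature.MathematicalPhysics.QuantumFieldTheory.Balaban1983to89.T3LevelShift
open Literature.MathematicalPhysics.QuantumFieldTheory.Balaban1983to89.T3UnitLawDensityEML (ℰp)
open Literature.MathematicalPhysics.QuantumFieldTheory.Balaban1983to89.T3TiltDescent
open Literature.MathematicalPhysics.QuantumFieldTheory.Balaban1983to89.T3CruxEstimates
open Literature.MathematicalPhysics.QuantumFieldTheory.Balaban1983to89.T3ConstrainedMinimiser
open Literature.MathematicalPhysics.QuantumFieldTheory.Balaban1983to89.T3DescentFibreTower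
open Literature.MathematicalPhysics.QuantumFieldTheory.Balaban1983to89.BlockAveragingSection
open Literature.MathematicalPhysics.QuantumFieldTheory.Balaban1983to89.BlockAveragingSectionPlaq

namespace Literature.MathematicalPhysics.QuantumFieldTheory.Balaban1983to89.T3SmallFibre

section Small

variable {P : Params} {G : Type*} [GaugeGroup G]

/-- An iterate of (0.4)-averagings admits `δ`-small preimages of `δ`-small fields (`δ > 0`, `k ≤ m + K`, every `ℰ` with `ℰ(1,…,1) = 1`).
[cite: Balaban1987RG1, (0.4)/(0.18) p.253] -/
theorem exists_small_preimage_iter (ℰ : LoopAverage G) (hE : ∀ n : ℕ, ℰ.E (fun _ : Fin (n + 1) => (1 : G)) = 1) {δ : ℝ}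
    (hδ : 0 < δ) : ∀ k : ℕ, k ≤ P.m + P.K → ∀ W : GaugeField P k G, PlaqSmall δ W →
      ∃ U : GaugeField P 0 G, Averaging.iter (fun i => BlockAveraging.blockAvg (P := P) (j := i) ℰ) k U = W ∧ PlaqSmall δ U
  | 0, _, W, hW => ⟨W, rfl, hW⟩
  | k + 1, hk, W, hW => by
    obtain ⟨W', hW'avg, hW'small⟩ := exists_small_preimage_blockAvg (j := k) (by omega) ℰ hE hδ hW
    obtain ⟨U, hU, hUsmall⟩ := exists_small_preimage_iter ℰ hE hδ k (by omega) W' hW'small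
    exact ⟨U, by show (BlockAveraging.blockAvg ℰ).avg (Averaging.iter _ k U) = W; rw [hU, hW'avg], hUsmall⟩

variable (F : T3Family) (ℰ : LoopAverage G)

/-- **THE SMALL-FIELD FIBRE IS NONEMPTY**: every `δ`-small datum `V` of the `n`-th approximation (`δ > 0`) has a `δ`-small configuration
of run `K` in its fibre `{U : D_{n,K}U = V}` (every `ℰ` with `ℰ(1,…,1) = 1`). [cite: Balaban1987RG1, (0.11)/(0.18) p.253] -/
theorem exists_mem_fibre_plaqSmall (hE : ∀ n : ℕ, ℰ.E (fun _ : Fin (n + 1) => (1 : G)) = 1) {n K : ℕ} (h : n ≤ K) {δ : ℝ}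
    (hδ : 0 < δ) {V : GaugeField (F.P n) 0 (G := G)} (hV : PlaqSmall δ V) :
    ∃ U ∈ fibre F ℰ n K h V, PlaqSmall δ U := by
  have hk : K - n ≤ (F.PP F.m K).m + (F.PP F.m K).K := by show K - n ≤ F.m + K; omega
  have hV' : PlaqSmall δ (fieldShift (F.sitesPerDir_eq (m := F.m) (K := K) (j := K - n) (m' := F.m) (K' := n) (j' := 0)
      (by omega)) V) := fun p => by
    rw [plaqHol_fieldShift]; exact hV _
  obtain ⟨U, hU, hUsmall⟩ := exists_small_preimage_iter (P := F.PP F.m K) ℰ hE hδ (K - n) hk _ hV'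
  refine ⟨U, ?_, hUsmall⟩
  show fieldShift _ (Averaging.iter (fun i => BlockAveraging.blockAvg (P := F.PP F.m K) (j := i) ℰ) (K - n) U) = V
  rw [hU, fieldShift_fieldShift]
  exact fieldShift_refl _ _

end Small

end Literature.MathematicalPhysics.QuantumFieldTheory.Balaban1983to89.T3SmallFibre

end
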